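import Summits.NavierStokesRegularity.NavierStokesRegularity.Theses.HodographBetchov
import Literature.Analysis.FluidPDE.TaoLocalisationHolds
import Literature.Analysis.FluidPDE.TaoLocalisationProofs
import Literature.Analysis.FluidPDE.NSHopfLimit

/-!
# `FastClassSqueeze` (stmt-NavierStokesRegularity-15832), line `birth`, stub 1: no fast-energy
# concentration FOLLOWS from strong `L²`-continuity at the final time

Route `HodographBetchov`, crux 3, registered skeleton `Cruxes/FastClassSqueeze/Lines/birth.lean`.
Its stub 1 `stub_no_fast_energy_concentration` asks, along every classical solution of unforced
Navier–Stokes on `ℝ³ × [0,T)` that is Leray–Hopf from a rapidly decaying datum, that the kinetic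
energy be uniformly integrable over speed classes up to `T`:
`∀ ε > 0 ∃ l > 0 ∀ t ∈ [0,T) : ∫_{|u(t)|>l} |u(t)|² ≤ ε`.

`stub_no_fast_energy_concentration_of_tendsto` proves this stub UNDER the hypothesis that the
trajectory is strongly `L²`-continuous into the final time from the left,
`‖u(t) − u(T)‖_{L²} → 0` as `t ↑ T` (`u(T)` is the Leray–Hopf slice at `T`, an `L²` field by the
definition of `IsLerayHopfOn`), i.e. under the ENERGY EQUALITY AT THE FIRST (possibly) SINGULAR TIME
(no anomalous dissipation at the instant `T`; for Leray–Hopf solutions weak `L²`-continuity holds, so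
strong continuity at `T` is exactly `‖u(t)‖₂ → ‖u(T)‖₂`).  Whether this holds for every Leray–Hopf
solution smooth on `(0,T)` is open (it is known under Type-I-in-time or `L^{3,∞}`-type hypotheses:
Leslie–Shvydkoy, SIAM J. Math. Anal. 50 (2018) 870–890, and the energy-measure paper ARMA 230 (2018));
so the theorem pins stub 1 to (one side of) that classical open question rather than settling it.

Proof.  Away from `T` the solution is bounded: on every closed slab `[0,τ] ⊂ [0,T)` Tao's persistence
of regularity (Tao 2013, Cor. 11.1 + Cor. 4.3 + Thm. 5.4 (iv), `tao2011_hasBoundedSobolevNormsOn_holds`)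
and the Sobolev imbedding (`linfty_bound_of_hasBoundedSobolevNormsOn_holds`) give `|u| ≤ M`, so the
fast class `{|u(t)| > l}` is EMPTY for `l > M` (`exists_forall_norm_le_on_closedSlab`).  Near `T`:
`|u(t)|² ≤ 2|u(t) − u(T)|² + 2|u(T)|²` pointwise (`enorm_sq_le_two_mul_add`); the first term has small TOTAL integral for `t`
close to `T` (strong continuity), the second has small integral over the fast class because
`|{|u(t)| > l}| ≤ 2E(u₀)/l²` uniformly in `t` (Chebyshev on the energy class,
`volume_fast_le`) and `|u(T)|² ∈ L¹` is absolutely continuous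
(`MeasureTheory.exists_pos_setLIntegral_lt_of_measure_lt`).
-/

noncomputable section

-- the summit and its single problem share the name `NavierStokesRegularity` (D-0017 nested layout)
set_option linter.dupNamespace false

namespace Summit.NavierStokesRegularity.NavierStokesRegularity.Theorems.FastClassSqueeze.Birth

open Set MeasureTheory Filter Topology Literature.Analysis.FluidPDE
open scoped ENNReal NNReal

/-- **Boundedness on closed sub-slabs.** A classical solution of unforced Navier–Stokes on
`ℝ³ × [0,T)` which is Leray–Hopf from its rapidly decaying datum is bounded on `[0,τ] × ℝ³` for every
`0 < τ < T`: the energy is `≤ 2E(u₀)` on the closed slab (energy inequality), so all Sobolev norms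
are bounded there (Tao 2013, Cor. 11.1 + Cor. 4.3 + Thm. 5.4 (iv)) and the Sobolev imbedding
`H² ⊂ C_B` bounds `u`. [cite: Tao2011, Cor. 11.1 + Cor. 4.3 + Thm. 5.4 (iv)] -/
theorem exists_forall_norm_le_on_closedSlab {ν T : ℝ} (hν : 0 < ν)
    {u : ℝ → EuclideanSpace ℝ (Fin 3) → EuclideanSpace ℝ (Fin 3)}
    {p : ℝ → EuclideanSpace ℝ (Fin 3) → ℝ}
    (hcl : IsClassicalNSSolutionOn (Ico 0 T) ν 0 u p) (hLH : IsLerayHopfOn T ν 0 (u 0) u)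
    (hdec : HasRapidSpatialDecay (u 0)) {τ : ℝ} (hτ : 0 < τ) (hτT : τ < T) :
    ∃ M : ℝ, ∀ t ∈ Icc 0 τ, ∀ x, ‖u t x‖ ≤ M := by
  have hsol : IsClassicalNSSolutionOn (Icc 0 τ) ν 0 u p :=
    hcl.mono (Icc_subset_Ico_right hτT) (uniqueDiffOn_Icc hτ)
  have hE : ∃ C : ℝ≥0, ∀ t ∈ Icc 0 τ, ∫⁻ x, ‖u t x‖ₑ ^ 2 ≤ C :=
    ⟨(ENNReal.ofReal (2 * VectorCalculus.kineticEnergy (u 0))).toNNReal, fun t ht => by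
      rw [ENNReal.coe_toNNReal ENNReal.ofReal_ne_top]
      exact hLH.lintegral_enorm_sq_le hν.le ⟨ht.1, ht.2.trans hτT.le⟩⟩
  have hH : HasBoundedSobolevNormsOn (Icc 0 τ) u :=
    tao2011_hasBoundedSobolevNormsOn_holds hν hτ hsol hE hdec
  exact linfty_bound_of_hasBoundedSobolevNormsOn_holds
    (fun t ht => (hsol.contDiff_velocity ht).of_le (by norm_cast)) hH

/-- **Chebyshev on the energy class.** For a Leray–Hopf solution with `f = 0`, `ν ≥ 0`, a time
`t ∈ [0,T]` at which the slice is a.e.-measurable, and a level `l > 0`, the fast class has measure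
`|{|u(t)| > l}| ≤ 2E(u₀)/l²` (`l² |{|u(t)| > l}| ≤ ∫ |u(t)|² ≤ 2E(u₀)` by the energy inequality).
[cite: Leray1934, (5.2)] -/
theorem volume_fast_le {T ν : ℝ} (hν : 0 ≤ ν)
    {u₀ : EuclideanSpace ℝ (Fin 3) → EuclideanSpace ℝ (Fin 3)}
    {u : ℝ → EuclideanSpace ℝ (Fin 3) → EuclideanSpace ℝ (Fin 3)}
    (hLH : IsLerayHopfOn T ν 0 u₀ u) {t : ℝ} (ht : t ∈ Icc 0 T)
    (hmeas : AEMeasurable (u t) volume) {l : ℝ} (hl : 0 < l) :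
    volume {x : EuclideanSpace ℝ (Fin 3) | l < ‖u t x‖} ≤
      ENNReal.ofReal (2 * VectorCalculus.kineticEnergy u₀ / l ^ 2) := by
  have hl2 : 0 < l ^ 2 := by positivity
  have hsub : {x : EuclideanSpace ℝ (Fin 3) | l < ‖u t x‖} ⊆
      {x | ENNReal.ofReal (l ^ 2) ≤ ‖u t x‖ₑ ^ 2} := by
    intro x hx
    have hx' : l < ‖u t x‖ := hx
    change ENNReal.ofReal (l ^ 2) ≤ ‖u t x‖ₑ ^ 2
    rw [← ofReal_norm, ← ENNReal.ofReal_pow (norm_nonneg _)]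
    exact ENNReal.ofReal_le_ofReal (by nlinarith [hx', hl])
  have hcheb := mul_meas_ge_le_lintegral₀ (μ := volume) (f := fun x => ‖u t x‖ₑ ^ 2)
    (hmeas.enorm.pow_const 2) (ENNReal.ofReal (l ^ 2))
  have hE := hLH.lintegral_enorm_sq_le hν ht
  have hne0 : ENNReal.ofReal (l ^ 2) ≠ 0 := (ENNReal.ofReal_pos.2 hl2).ne'
  calc volume {x : EuclideanSpace ℝ (Fin 3) | l < ‖u t x‖}
      ≤ volume {x | ENNReal.ofReal (l ^ 2) ≤ ‖u t x‖ₑ ^ 2} := measure_mono hsub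
    _ ≤ ENNReal.ofReal (2 * VectorCalculus.kineticEnergy u₀) / ENNReal.ofReal (l ^ 2) := by
        rw [ENNReal.le_div_iff_mul_le (Or.inl hne0) (Or.inl ENNReal.ofReal_ne_top), mul_comm]
        exact hcheb.trans hE
    _ = ENNReal.ofReal (2 * VectorCalculus.kineticEnergy u₀ / l ^ 2) :=
        (ENNReal.ofReal_div_of_pos hl2).symm

/-- **Stub 1 of line `birth` under strong `L²`-continuity at the final time.** Let `(u,p)` be a
classical solution of unforced Navier–Stokes on `ℝ³ × [0,T)` which is Leray–Hopf on `[0,T)` from its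
rapidly decaying datum, and assume `‖u(t) − u(T)‖_{L²} → 0` as `t ↑ T` (energy equality at the first
possibly singular time; `u(T)` is the Leray–Hopf slice).  Then the kinetic energy is uniformly
integrable over speed classes up to `T`: for every `ε > 0` there is `l > 0` with
`∫_{|u(t)|>l} |u(t)|² ≤ ε` for all `t ∈ [0,T)`.  Proof: on `[0,τ]`, `τ < T`, the solution is bounded
(Tao 2013 persistence + Sobolev imbedding), so the fast class is empty for large `l`; on `(τ,T)`,
`|u(t)|² ≤ 2|u(t)−u(T)|² + 2|u(T)|²`, the first integral is small by strong continuity and the second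
is small over the fast class, whose measure is `≤ 2E(u₀)/l²` (Chebyshev), by absolute continuity of
`|u(T)|² ∈ L¹`. [cite: Tao2011, Cor. 11.1 + Cor. 4.3 + Thm. 5.4 (iv)] -/
theorem stub_no_fast_energy_concentration_of_tendsto :
    ∀ (ν T : ℝ), 0 < ν → 0 < T →
      ∀ (u : ℝ → EuclideanSpace ℝ (Fin 3) → EuclideanSpace ℝ (Fin 3))
        (p : ℝ → EuclideanSpace ℝ (Fin 3) → ℝ),
        Literature.Analysis.FluidPDE.IsClassicalNSSolutionOn (Set.Ico 0 T) ν 0 u p →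
        Literature.Analysis.FluidPDE.IsLerayHopfOn T ν 0 (u 0) u →
        Literature.Analysis.FluidPDE.HasRapidSpatialDecay (u 0) →
        Filter.Tendsto (fun t => MeasureTheory.eLpNorm (u t - u T) 2 MeasureTheory.volume)
          (nhdsWithin T (Set.Iio T)) (nhds 0) →
        ∀ ε : ℝ, 0 < ε → ∃ l : ℝ, 0 < l ∧ ∀ t ∈ Set.Ico 0 T,
          ∫⁻ x in {x : EuclideanSpace ℝ (Fin 3) | l < ‖u t x‖}, ‖u t x‖ₑ ^ 2 ≤ ENNReal.ofReal ε := by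
  intro ν T hν hT u p hcl hLH hdec hsc ε hε
  -- ### the final slice is `L²`; absolute continuity of `|u(T)|²`
  have hmemT : MemLp (u T) 2 volume := hLH.memLp T ⟨hT.le, le_rfl⟩
  have hTmeas : AEMeasurable (u T) volume := hmemT.aestronglyMeasurable.aemeasurable
  have hsq_eq : ∀ f : EuclideanSpace ℝ (Fin 3) → EuclideanSpace ℝ (Fin 3),
      ∫⁻ x, ‖f x‖ₑ ^ 2 = eLpNorm f 2 volume ^ 2 := by
    intro f
    have h := lintegral_rpow_enorm_eq_rpow_eLpNorm' (μ := volume) (f := f) (q := 2) two_pos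
    have h2 : eLpNorm f 2 volume = eLpNorm' f 2 volume := by
      rw [eLpNorm_eq_eLpNorm' two_ne_zero ENNReal.ofNat_ne_top, ENNReal.toReal_ofNat]
    rw [h2]
    simpa [ENNReal.rpow_two] using h
  have hfinT : ∫⁻ x, ‖u T x‖ₑ ^ 2 ≠ ⊤ := by
    rw [hsq_eq]
    exact (ENNReal.pow_lt_top hmemT.eLpNorm_lt_top).ne
  have hε4 : ENNReal.ofReal (ε / 4) ≠ 0 := (ENNReal.ofReal_pos.2 (by positivity)).ne'
  obtain ⟨δ, hδ0, hδ⟩ := exists_pos_setLIntegral_lt_of_measure_lt hfinT hε4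
  -- ### strong continuity: `∫ |u(t) − u(T)|² < ε/4` on some `(τ₀, T)`
  have hroot : 0 < Real.sqrt (ε / 4) := Real.sqrt_pos.2 (by positivity)
  have hev : ∀ᶠ t in 𝓝[<] T, eLpNorm (u t - u T) 2 volume < ENNReal.ofReal (Real.sqrt (ε / 4)) :=
    hsc (gt_mem_nhds (ENNReal.ofReal_pos.2 hroot))
  obtain ⟨τ₀, hτ₀T, hτ₀⟩ := mem_nhdsLT_iff_exists_Ioo_subset.1 hev
  have hclose : ∀ t ∈ Ioo τ₀ T, ∫⁻ x, ‖u t x - u T x‖ₑ ^ 2 < ENNReal.ofReal (ε / 4) := by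
    intro t ht
    have h1 : eLpNorm (u t - u T) 2 volume < ENNReal.ofReal (Real.sqrt (ε / 4)) := hτ₀ ht
    have h2 : ∫⁻ x, ‖u t x - u T x‖ₑ ^ 2 = eLpNorm (u t - u T) 2 volume ^ 2 := hsq_eq (u t - u T)
    rw [h2]
    calc eLpNorm (u t - u T) 2 volume ^ 2 < ENNReal.ofReal (Real.sqrt (ε / 4)) ^ 2 :=
          ENNReal.pow_lt_pow_left two_ne_zero h1
      _ = ENNReal.ofReal (ε / 4) := by
          rw [← ENNReal.ofReal_pow hroot.le, Real.sq_sqrt (by positivity)]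
  -- ### the closed slab `[0, τ]`, `τ₀ < τ < T`: `u` is bounded there
  set τ : ℝ := (max τ₀ 0 + T) / 2 with hτ_def
  have hτ0 : 0 < τ := by
    rw [hτ_def]; have := le_max_right τ₀ 0; linarith
  have hτT : τ < T := by
    rw [hτ_def]; have : max τ₀ 0 < T := max_lt hτ₀T hT; linarith
  have hτ₀τ : τ₀ < τ := by
    rw [hτ_def]; have := le_max_left τ₀ 0; have : max τ₀ 0 < T := max_lt hτ₀T hT; linarith
  obtain ⟨M, hM⟩ := exists_forall_norm_le_on_closedSlab hν hcl hLH hdec hτ0 hτT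
  -- ### the Chebyshev level: `2E(u₀)/l₁² < δ`
  set E₂ : ℝ := 2 * VectorCalculus.kineticEnergy (u 0) with hE₂
  have hE₂0 : 0 ≤ E₂ := by
    rw [hE₂]; exact mul_nonneg zero_le_two (kineticEnergy_nonneg _)
  set δ₁ : ℝ≥0∞ := min δ 1 with hδ₁
  have hδ₁top : δ₁ ≠ ⊤ := ne_top_of_le_ne_top ENNReal.one_ne_top (min_le_right _ _)
  have hδ₁0 : δ₁ ≠ 0 := (lt_min hδ0 zero_lt_one).ne'
  have hδr : 0 < δ₁.toReal := ENNReal.toReal_pos hδ₁0 hδ₁top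
  set l₁ : ℝ := Real.sqrt (E₂ / δ₁.toReal) + 1 with hl₁
  have hl₁0 : 0 < l₁ := by rw [hl₁]; positivity
  have hcheb_lt : ENNReal.ofReal (E₂ / l₁ ^ 2) < δ := by
    have hlt : E₂ / l₁ ^ 2 < δ₁.toReal := by
      rw [div_lt_iff₀ (by positivity)]
      have hs : Real.sqrt (E₂ / δ₁.toReal) ^ 2 = E₂ / δ₁.toReal := Real.sq_sqrt (by positivity)
      have hs0 : 0 ≤ Real.sqrt (E₂ / δ₁.toReal) := Real.sqrt_nonneg _
      have h1 : E₂ = δ₁.toReal * Real.sqrt (E₂ / δ₁.toReal) ^ 2 := by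
        rw [hs]; field_simp
      rw [h1, hl₁]
      have h2 : Real.sqrt (E₂ / δ₁.toReal) ^ 2 < (Real.sqrt (E₂ / δ₁.toReal) + 1) ^ 2 := by nlinarith
      exact mul_lt_mul_of_pos_left h2 hδr
    calc ENNReal.ofReal (E₂ / l₁ ^ 2) < ENNReal.ofReal δ₁.toReal :=
          (ENNReal.ofReal_lt_ofReal_iff hδr).2 hlt
      _ = δ₁ := ENNReal.ofReal_toReal hδ₁top
      _ ≤ δ := min_le_left _ _
  -- ### the level
  set l : ℝ := max l₁ (max M 0 + 1) with hl_def
  have hl0 : 0 < l := lt_max_of_lt_left hl₁0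
  refine ⟨l, hl0, fun t ht => ?_⟩
  rcases le_or_gt t τ with htτ | hτt
  · -- `t ≤ τ`: the fast class is empty
    have hempty : {x : EuclideanSpace ℝ (Fin 3) | l < ‖u t x‖} = ∅ := by
      refine Set.eq_empty_of_forall_notMem fun x hx => ?_
      have h1 : ‖u t x‖ ≤ M := hM t ⟨ht.1, htτ⟩ x
      have h2 : M < l :=
        ((le_max_left M 0).trans_lt (lt_add_one _)).trans_le (le_max_right _ _)
      exact absurd (h1.trans_lt h2) (not_lt.2 (le_of_lt hx))
    rw [hempty, Measure.restrict_empty, lintegral_zero_measure]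
    exact bot_le
  · -- `τ < t < T`: split `|u(t)|² ≤ 2|u(t) − u(T)|² + 2|u(T)|²`
    have htI : t ∈ Ioo τ₀ T := ⟨hτ₀τ.trans hτt, ht.2⟩
    have htmeas : AEMeasurable (u t) volume :=
      (hcl.contDiff_velocity ht).continuous.measurable.aemeasurable
    set F : Set (EuclideanSpace ℝ (Fin 3)) := {x | l < ‖u t x‖} with hF
    -- measure of the fast class
    have hvol : volume F < δ := by
      have h1 : volume F ≤ ENNReal.ofReal (E₂ / l ^ 2) :=
        volume_fast_le hν.le hLH ⟨ht.1, ht.2.le⟩ htmeas hl0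
      have h2 : ENNReal.ofReal (E₂ / l ^ 2) ≤ ENNReal.ofReal (E₂ / l₁ ^ 2) := by
        refine ENNReal.ofReal_le_ofReal (div_le_div_of_nonneg_left hE₂0 (by positivity) ?_)
        exact pow_le_pow_left₀ hl₁0.le (le_max_left _ _) 2
      exact (h1.trans h2).trans_lt hcheb_lt
    have hdiff_meas : AEMeasurable (fun x => 2 * ‖u t x - u T x‖ₑ ^ 2) (volume.restrict F) :=
      (((htmeas.sub hTmeas).enorm.pow_const 2).const_mul 2).restrict
    calc ∫⁻ x in F, ‖u t x‖ₑ ^ 2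
        ≤ ∫⁻ x in F, (2 * ‖u t x - u T x‖ₑ ^ 2 + 2 * ‖u T x‖ₑ ^ 2) :=
          lintegral_mono fun x => enorm_sq_le_two_mul_add (u t x) (u T x)
      _ = (∫⁻ x in F, 2 * ‖u t x - u T x‖ₑ ^ 2) + ∫⁻ x in F, 2 * ‖u T x‖ₑ ^ 2 :=
          lintegral_add_left' hdiff_meas _
      _ = 2 * (∫⁻ x in F, ‖u t x - u T x‖ₑ ^ 2) + 2 * ∫⁻ x in F, ‖u T x‖ₑ ^ 2 := by
          rw [lintegral_const_mul' _ _ ENNReal.ofNat_ne_top,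
            lintegral_const_mul' _ _ ENNReal.ofNat_ne_top]
      _ ≤ 2 * (∫⁻ x, ‖u t x - u T x‖ₑ ^ 2) + 2 * ∫⁻ x in F, ‖u T x‖ₑ ^ 2 := by
          gcongr
          exact Measure.restrict_le_self
      _ ≤ 2 * ENNReal.ofReal (ε / 4) + 2 * ENNReal.ofReal (ε / 4) := by
          gcongr
          · exact (hclose t htI).le
          · exact (hδ F hvol).le
      _ = ENNReal.ofReal ε := by
          rw [← ENNReal.ofReal_ofNat 2, ← ENNReal.ofReal_mul (by norm_num),
            ← ENNReal.ofReal_add (by positivity) (by positivity)]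
          congr 1
          ring

end Summit.NavierStokesRegularity.NavierStokesRegularity.Theorems.FastClassSqueeze.Birth

end
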